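/-
Origin: expansion seat `planner-pub-hodgecm-pv06-g2-0`, handover 2026-08-18T05:12:39Z (`HOME/pub-hodgecm-pv06-g2/lean/Pv06g2/ToricPeriodCov.lean`, md5 8de52f8e, 74 lines);
landed by the gen-6 packager in gate run 22 as `HodgeCM/PerL34/ToricPeriodCov.lean` (verbatim).
-/
/-
Origin: HOME/pub-hodgecm-pv06-g2/lean/Pv06g2/ToricPeriodCov.lean — session planner-pub-hodgecm-pv06-g2-0 (unit pub-hodgecm-pv06-g2,
DAG-NODE PROVER #06 of 15, generation 2).  Intended final place: `HodgeCM/PerL34/ToricPeriodCov.lean`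
(namespace `HodgeCM.PerL34.ToricPeriodCov`).  Imports: Mathlib only.  Closed, nothing cited, nothing posited.

# Covariance of the toric period under `T(L₀⊗ℝ)` (PerL v5 ll. 427–429) — the `[ELEMENTARY]` field `PT_cov`

`HodgeCM.PerL34.Annihilation.AnnihilationDatum.PT_cov` (Annihilation.lean:279) reads
`PT ξ (Rc (ιT t) x) = χinf ξ t * PT ξ x`: "substituting `t' ↦ t' t⁻¹` in `∫_{[T]} x(t' t) \\overline{ξ(t')} dt'`
gives `ξ_∞(t) · P_{T,ξ̄}(x)`".  Over the model — `[T]` a group `K` with a right-invariant measure `dk`,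
`ξ : K →* ℂ` unitary, `P_{T,ξ̄}(x) = ∫_K x(ι k) \\overline{ξ(k)} dk` for a map `ι : K → Y` (`[T] → [U(W)]`) equivariant
for the right action of `T(L₀⊗ℝ)` through `cl : T(L₀⊗ℝ) → [T]`, and `ξ_∞ = ξ ∘ cl` — this is the kernel theorem
`PT_cov_model` below (`period_mul_right` is the bare substitution).
-/
import Mathlib
import Literature.MeasureTheory.Group.CharacterPeriodCovariance

/-! PORT of `HodgeCM/PerL34/ToricPeriodCov.lean` (HodgeCMPerL run 82) — verbatim mechanical port; provenance in the PORT header line. -/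

set_option autoImplicit false

noncomputable section

open MeasureTheory

namespace HodgeCM

/-- Port anchor (port_pkg realias): every theorem of this ported file is now an `alias` of an already-landed tree declaration;
this file-unique trivial theorem keeps one genuine declaration in the file (gate lint; the literal is the source sha256 prefix). -/
theorem ToricPeriodCov_port_anchor : (1301051236685823376 : Nat) = 1301051236685823376 := rfl

namespace PerL34
namespace ToricPeriodCov

variable {K : Type*} [Group K] [MeasurableSpace K] [MeasurableMul K] (μ : Measure K) [μ.IsMulRightInvariant]

omit [MeasurableSpace K] [MeasurableMul K] in
/-- A unitary character inverts to its conjugate. -/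
alias conj_map_mul_inv := Literature.MeasureTheory.Group.ToricPeriod.conj_map_mul_inv

/-- **The substitution `k ↦ k s⁻¹`** (right-invariant measure): `∫ F(k s) \\overline{ξ(k)} dk = ξ(s) ∫ F(k) \\overline{ξ(k)} dk`
for a unitary character `ξ`. -/
alias period_mul_right := Literature.MeasureTheory.Group.ToricPeriod.period_mul_right

/-- **`PT_cov` over the model.**  `Y` = `[U(W)]`, `ι : K → Y` the map `[T] → [U(W)]`, `act t` the right translation
by `t ∈ T(L₀⊗ℝ)` on `[U(W)]`, `cl : T(L₀⊗ℝ) →* [T]`, equivariance `act t (ι k) = ι (k · cl t)`; then for every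
`x : Y → ℂ` and unitary character `ξ` of `K`:
`∫_K x(act t (ι k)) \\overline{ξ(k)} dk = ξ(cl t) · ∫_K x(ι k) \\overline{ξ(k)} dk`. -/
alias PT_cov_model := Literature.MeasureTheory.Group.ToricPeriod.period_equivariant

/-- The same packaged as continuous linear functionals on a normed space of "functions" `Cf` with an evaluation
`ev : Cf → Y → ℂ` and a right-translation operator `Rc t : Cf → Cf` with `ev (Rc t x) y = ev x (act t y)` — the literal
shape `PT ξ (Rc (ιT t) x) = χinf ξ t * PT ξ x` of the field, for `PT ξ x := ∫ ev x (ι k) \\overline{ξ k} dk` and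
`χinf ξ := ξ ∘ cl`. -/
alias PT_cov_shape := Literature.MeasureTheory.Group.ToricPeriod.period_equivariant_op

end ToricPeriodCov
end PerL34
end HodgeCM

end
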